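import Summits.Schanuel.Schanuel.Theorems.RootDecomp1KHyper40

/-!
# RootDecomp1KHyper — lens 6, generation 15 ADDENDA (ExpAnchorT v2 88910796… §1–§6 · PiAnchorT b5ead9a0… §7 · PiAnchorU ed654c66… §8–§9) — continuation (RootDecomp1KHyper41): §9 (ll. 3485–3654) ℚ(θ)-RATIONAL anchors (FIRST″ at relative degree one): `WeakLatLB.of_mul_left`, `HyperLatApprox.mul_left`, `algebraicIndependent_option_of_mul`, `sb_three_of_measuredRatAnchor`, `sb_three_of_pi_cexp_pi_div`

(lens-6 g15 addenda: `ExpAnchorT.lean` v2 88910796… = parts 28–35, `PiAnchorT.lean` b5ead9a0… §7 = parts 36–37, `PiAnchorU.lean` ed654c66… §8–§9 (U ll. 2881–3654; A–I byte-identical to T up to the two lint fixes) = parts 38–41;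
farm rc 0 · 0 sorry · axioms std; port by census-1 gen 14, CENSUS-REQUESTs STATUS L1561 / L1583 / L1616, critic PORT GO L1568 (e) / L1588 (e) / L1617 (e); import `RootDecomp1KHyper26` (+ the two Nesterenko Literature modules from part 36 on),
sub-namespace `…HyperCell.LatCell`; statements and proofs verbatim (docstrings added, generic one-liners privatised; lint fixes: L1588 (a)'s two in §7c and two unused simp args `Matrix.head_cons` in §8a); binders hLW / h52 / hNW BY NAME; `--supports stmt-Schanuel-33363` (residual of record n = 3 := UnanchoredResidual₃‴, critic L1617 (c)). Nothing here proves Schanuel; rung 0.)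
-/

noncomputable section

open Complex IntermediateField Polynomial

namespace Summit.Schanuel.Schanuel.Theorems.RootDecomp1KHyper

namespace HyperCell

namespace LatCell

variable {n : ℕ}
open Summit.Schanuel.Schanuel.Theorems.RootDecomp1KGeneric (HasHLPairInSpan Rank3SpanResidual
  mem_adjoin_of_mem_span cexp_mem_adjoin_of_mem_span)

/-! ## §9  ℚ(θ)-RATIONAL anchors: FIRST″ at relative degree one

The uniform theorem of §8 with anchors `vᵢ = Wᵢ(θ)/q(θ) ∈ ℚ(θ)` (`q(θ) ≠ 0`) instead of `Wᵢ(θ) ∈ ℤ[θ]`: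
the weak lattice bound and the hyper-approximation both scale by the constant `q(θ)` at the cost of
finitely many levels, the engine then shows `(q(θ) z_j, θ)` algebraically independent, and transcendence
of `z_j` over `ℚ(θ)` descends from that of `q(θ) z_j` (`q(θ) ∈ ℚ[θ]`).  What is still NOT reached is
relative degree ≥ 2 (anchors algebraic over `ℚ(θ)` but outside `ℚ(θ)`): that needs a relative Liouville
inequality (NODE addendum 3 §4). -/

/-- Scaling a weak lattice bound: if `c vᵢ = wᵢ` with `c ≠ 0` then `WeakLatLB w₁ w₂ → WeakLatLB v₁ v₂`. -/
theorem WeakLatLB.of_mul_left {w₁ w₂ v₁ v₂ c : ℂ} (h : WeakLatLB w₁ w₂) (hc : c ≠ 0)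
    (h₁ : c * v₁ = w₁) (h₂ : c * v₂ = w₂) : WeakLatLB v₁ v₂ := by
  obtain ⟨C, k, hC, hall⟩ := h
  have hc0 : 0 < ‖c‖ := norm_pos_iff.mpr hc
  set L : ℝ := max 0 (Real.log ‖c‖) with hL
  have hL0 : 0 ≤ L := le_max_left _ _
  refine ⟨C + L, k, by positivity, fun U V hUV => ?_⟩
  have h1 := hall U V hUV
  have heq : (U : ℂ) * w₁ + (V : ℂ) * w₂ = c * ((U : ℂ) * v₁ + (V : ℂ) * v₂) := by
    rw [← h₁, ← h₂]; ring
  rw [heq, norm_mul] at h1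
  set X : ℝ := 1 + |(U : ℝ)| + |(V : ℝ)| with hX
  have hX1 : 1 ≤ X := by rw [hX]; linarith [abs_nonneg (U : ℝ), abs_nonneg (V : ℝ)]
  have hXk : 1 ≤ X ^ k := one_le_pow₀ hX1
  have hlog : Real.log ‖c‖ ≤ L * X ^ k :=
    (le_max_right _ _).trans (le_mul_of_one_le_right hL0 hXk)
  have hexpL : Real.exp (-(L * X ^ k)) ≤ 1 / ‖c‖ := by
    rw [Real.exp_neg, ← one_div]
    exact one_div_le_one_div_of_le hc0
      ((Real.exp_log hc0).symm.le.trans (Real.exp_le_exp.mpr hlog))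
  calc Real.exp (-((C + L) * X ^ k))
      = Real.exp (-(C * X ^ k)) * Real.exp (-(L * X ^ k)) := by
        rw [add_mul, neg_add, Real.exp_add]
    _ ≤ ‖c‖ * ‖(U : ℂ) * v₁ + (V : ℂ) * v₂‖ * (1 / ‖c‖) :=
        mul_le_mul h1 hexpL (Real.exp_pos _).le (by positivity)
    _ = ‖(U : ℂ) * v₁ + (V : ℂ) * v₂‖ := by field_simp

/-- Scaling a hyper-approximation by a non-zero constant (finitely many levels are lost). -/
theorem HyperLatApprox.mul_left {w₁ w₂ y : ℂ} (h : HyperLatApprox w₁ w₂ y) {c : ℂ} (hc : c ≠ 0) :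
    HyperLatApprox (c * w₁) (c * w₂) (c * y) := by
  have hc0 : 0 < ‖c‖ := norm_pos_iff.mpr hc
  set L : ℝ := max 0 (Real.log ‖c‖) with hL
  have hL0 : 0 ≤ L := le_max_left _ _
  obtain ⟨T, hT⟩ := exists_le_two_pow (1 + L)
  intro m
  obtain ⟨A, B, E, hE, hne, hlt⟩ := h (m + T)
  refine ⟨A, B, E, hE, ?_, ?_⟩
  · intro heq
    apply hne
    have : c * y = c * (((A : ℂ) * w₁ + (B : ℂ) * w₂) / (E : ℂ)) := by rw [heq]; ring
    exact mul_left_cancel₀ hc this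
  · have heq : c * y - ((A : ℂ) * (c * w₁) + (B : ℂ) * (c * w₂)) / (E : ℂ) =
        c * (y - ((A : ℂ) * w₁ + (B : ℂ) * w₂) / (E : ℂ)) := by ring
    rw [heq, norm_mul]
    set X : ℝ := 1 + (E : ℝ) + |(A : ℝ)| + |(B : ℝ)| with hX
    have hX2 : 2 ≤ X := by
      have hE1 : (1 : ℝ) ≤ (E : ℝ) := by exact_mod_cast hE
      rw [hX]; linarith [abs_nonneg (A : ℝ), abs_nonneg (B : ℝ)]
    have hX1 : 1 ≤ X := by linarith
    have hXm : 1 ≤ X ^ m := one_le_pow₀ hX1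
    have hbig : X ^ m + L ≤ X ^ (m + T) := by
      have h2T : 1 + L ≤ X ^ T := hT.trans (pow_le_pow_left₀ (by norm_num) hX2 T)
      calc X ^ m + L ≤ X ^ m * (1 + L) := by nlinarith [hXm, hL0]
        _ ≤ X ^ m * X ^ T := mul_le_mul_of_nonneg_left h2T (by positivity)
        _ = X ^ (m + T) := by rw [pow_add]
    have hexpL : Real.exp (-L) ≤ 1 / ‖c‖ := by
      rw [Real.exp_neg, ← one_div]
      exact one_div_le_one_div_of_le hc0
        ((Real.exp_log hc0).symm.le.trans (Real.exp_le_exp.mpr (le_max_right _ _)))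
    calc ‖c‖ * ‖y - ((A : ℂ) * w₁ + (B : ℂ) * w₂) / (E : ℂ)‖
        < ‖c‖ * Real.exp (-(X ^ (m + T))) := mul_lt_mul_of_pos_left hlt hc0
      _ ≤ ‖c‖ * Real.exp (-(X ^ m + L)) :=
          mul_le_mul_of_nonneg_left (Real.exp_le_exp.mpr (neg_le_neg hbig)) hc0.le
      _ = ‖c‖ * Real.exp (-L) * Real.exp (-(X ^ m)) := by rw [neg_add, Real.exp_add]; ring
      _ ≤ ‖c‖ * (1 / ‖c‖) * Real.exp (-(X ^ m)) := by gcongr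
      _ = Real.exp (-(X ^ m)) := by field_simp

/-- Integer polynomials in `θ` lie in `ℚ[θ]`. -/
private theorem aeval_int_mem_adjoin {n : ℕ} (θ : Fin n → ℂ) (q : MvPolynomial (Fin n) ℤ) :
    MvPolynomial.aeval θ q ∈ Algebra.adjoin ℚ (Set.range θ) := by
  apply MvPolynomial.induction_on q
  · intro a
    rw [MvPolynomial.aeval_C, algebraMap_int_eq, Int.coe_castRingHom]
    exact intCast_mem (Algebra.adjoin ℚ (Set.range θ)) a
  · intro p p' hp hp'
    rw [map_add]; exact add_mem hp hp'
  · intro p i hp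
    rw [map_mul, MvPolynomial.aeval_X]; exact mul_mem hp (Algebra.subset_adjoin ⟨i, rfl⟩)

/-- Transcendence descent: if `(c y, θ)` is algebraically independent with `c ∈ ℚ[θ]`, `c ≠ 0`, so is
`(y, θ)`. -/
theorem algebraicIndependent_option_of_mul {n : ℕ} {θ : Fin n → ℂ} {y c : ℂ}
    (hc : c ∈ Algebra.adjoin ℚ (Set.range θ)) (hθ : AlgebraicIndependent ℚ θ)
    (h : AlgebraicIndependent ℚ (fun o : Option (Fin n) => o.elim (c * y) θ)) :
    AlgebraicIndependent ℚ (fun o : Option (Fin n) => o.elim y θ) := by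
  rw [hθ.option_iff_transcendental] at h ⊢
  intro hy
  apply h
  have hc' : IsAlgebraic (Algebra.adjoin ℚ (Set.range θ)) c := by
    simpa using isAlgebraic_algebraMap (R := Algebra.adjoin ℚ (Set.range θ)) (A := ℂ)
      (⟨c, hc⟩ : Algebra.adjoin ℚ (Set.range θ))
  exact hc'.mul hy

/-- **FIRST″ AT RELATIVE DEGREE ONE (ℚ(θ)-rational anchors).**  Let `θ` be any pair with a weak
simultaneous measure inside `ℚ(z, e^z, i)`, `q(θ) ≠ 0`, and let `v₁ = W₁(θ)/q(θ)`, `v₂ = W₂(θ)/q(θ)`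
(`W₁, W₂` polynomially independent) lie in `span_ℤ(z)`.  Then the ℚ-free `HyperLinLiouville` triple
`z` has Schanuel's bound.  NO named fact in the statement. -/
theorem sb_three_of_measuredRatAnchor {z : Fin 3 → ℂ} (hz : LinearIndependent ℚ z)
    (hH : HyperLinLiouville z) {θ : Fin 2 → ℂ} (hθ : MvWeakMeasure θ)
    (hθz : ∀ i, θ i ∈ adjoin ℚ (SFset z ∪ {I})) (W₁ W₂ q : MvPolynomial (Fin 2) ℤ)
    (hq : MvPolynomial.aeval θ q ≠ 0)
    (hW : ∀ U V : ℤ, (U ≠ 0 ∨ V ≠ 0) → MvPolynomial.C U * W₁ + MvPolynomial.C V * W₂ ≠ 0)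
    {v₁ v₂ : ℂ} (hv₁ : MvPolynomial.aeval θ q * v₁ = MvPolynomial.aeval θ W₁)
    (hv₂ : MvPolynomial.aeval θ q * v₂ = MvPolynomial.aeval θ W₂)
    (h₁ : v₁ ∈ Submodule.span ℤ (Set.range z)) (h₂ : v₂ ∈ Submodule.span ℤ (Set.range z)) :
    SB 3 z := by
  have hLB : WeakLatLB v₁ v₂ := (weakLatLB_of_mvWeakMeasure hθ W₁ W₂ hW).of_mul_left hq hv₁ hv₂
  obtain ⟨a, ha⟩ := (Submodule.mem_span_range_iff_exists_fun ℤ).mp h₁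
  obtain ⟨b, hb⟩ := (Submodule.mem_span_range_iff_exists_fun ℤ).mp h₂
  simp only [zsmul_eq_mul] at ha hb
  obtain ⟨j, hj⟩ := exists_cvec_ne_zeroW hLB ha hb
  have hy := (hyperLatApprox_of_anchorW hz hH hLB ha hb hj).mul_left hq
  rw [hv₁, hv₂] at hy
  have hai := algebraicIndependent_option_of_mvWeakMeasure_hyperLat hθ W₁ W₂ hy
  have hai' := algebraicIndependent_option_of_mul (aeval_int_mem_adjoin θ q)
    (algebraicIndependent_of_mvWeakMeasure hθ) hai
  refine sb_of_algebraicIndependent hai' (by simp) fun o => ?_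
  cases o with
  | none => exact mem_adjoin_SFset_I' (Or.inl ⟨j, rfl⟩)
  | some i => exact hθz i

/-- `x₁ (x₁ + 3)` is polynomially independent of `x₀`. -/
theorem X1q_indep_X0 (U V : ℤ) (hUV : U ≠ 0 ∨ V ≠ 0) :
    MvPolynomial.C U * (MvPolynomial.X 1 * (MvPolynomial.X 1 + MvPolynomial.C 3)) +
      MvPolynomial.C V * (MvPolynomial.X 0 : MvPolynomial (Fin 2) ℤ) ≠ 0 := by
  intro h
  have e0 := congr_arg (MvPolynomial.eval (![0, 1] : Fin 2 → ℤ)) h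
  have e1 := congr_arg (MvPolynomial.eval (![1, 0] : Fin 2 → ℤ)) h
  simp only [map_add, map_mul, MvPolynomial.eval_C, MvPolynomial.eval_X, map_zero,
    Matrix.cons_val_one, Matrix.cons_val_zero, mul_zero, add_zero,
    mul_one, zero_add, zero_mul, one_mul] at e0 e1
  have hU : U = 0 := by omega
  rcases hUV with h' | h'
  · exact h' hU
  · exact h' e1

/-- **A ℚ(θ)-rational Nesterenko cell (mod Cor. 5.2 ONLY): `span_ℤ(z) ∋ π, e^{π}/(π + 3)`** — an anchor
OUTSIDE `ℤ[e^{π}, π]`, reached by §9 (`θ = (e^π, π)`, `q = x₁ + 3`, `W₁ = x₁ q`, `W₂ = x₀`). -/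
theorem sb_three_of_pi_cexp_pi_div
    (h52 : Literature.Barriers.Schanuel.NesterenkoPhilippon2001_ch3_cor_5_2)
    {z : Fin 3 → ℂ} (hz : LinearIndependent ℚ z) (hH : HyperLinLiouville z)
    (hπ : (Real.pi : ℂ) ∈ Submodule.span ℤ (Set.range z))
    (he : cexp (Real.pi : ℂ) / ((Real.pi : ℂ) + 3) ∈ Submodule.span ℤ (Set.range z)) : SB 3 z := by
  have hθz : ∀ i, θπ i ∈ adjoin ℚ (SFset z ∪ {I}) := by
    intro i
    match i with
    | 0 => exact cexp_mem_adjoin_of_mem_span hπ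
    | 1 => exact mem_adjoin_of_mem_span hπ
  have hq0 : (Real.pi : ℂ) + 3 ≠ 0 := by
    have : ((Real.pi + 3 : ℝ) : ℂ) ≠ 0 :=
      Complex.ofReal_ne_zero.mpr (by positivity : (Real.pi + 3 : ℝ) ≠ 0)
    simpa using this
  have hq : MvPolynomial.aeval θπ (MvPolynomial.X 1 + MvPolynomial.C 3 : MvPolynomial (Fin 2) ℤ) ≠ 0 := by
    simpa using hq0
  refine sb_three_of_measuredRatAnchor hz hH (mvWeakMeasure_θπ h52) hθz
    (MvPolynomial.X 1 * (MvPolynomial.X 1 + MvPolynomial.C 3)) (MvPolynomial.X 0)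
    (MvPolynomial.X 1 + MvPolynomial.C 3) hq X1q_indep_X0 ?_ ?_ hπ he
  · simp; ring
  · simp; field_simp

end LatCell

end HyperCell

end Summit.Schanuel.Schanuel.Theorems.RootDecomp1KHyper
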